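import Mathlib
import Literature.Computability.Complexity.CircuitClasses
import Literature.Computability.Complexity.CircuitClassesProofs
import Literature.Computability.Complexity.Promise
import Literature.Computability.MetaComplexity.FormulaModelsAE
import Literature.Computability.MetaComplexity.OliveiraPichSanthanam2019.GapMKtPMagnification
import HarnessLib

/-!
# Pointwise lower bounds for promise problems: "for all large `N`, no `N`-input circuit of the class
# solves `Π` at length `N`" (`Π ∉ i.o.𝒞(s)`), and its relation to the almost-everywhere classes
# `FamilyAE`

Vocabulary file (two definitions + folklore API, no named facts) for the hardness-magnification
census rows whose printed lower-bound statements are INFINITELY-OFTEN NEGATED, i.e. of the form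
*"for all large `N ∈ ℕ`, there exists no `𝒞`-circuit of size `s(N)` that computes `Π`"* —
S. Hirahara, *Non-disjoint promise problems from meta-computational view of pseudorandom generator
constructions*, Theory of Computing 19(4) (2023) (bib key `Hirahara2023NonDisjoint`; CCC 2020),
Thm. 1.11 items 3–4, Prop. B.1, Thm. 1.12 items 3–4 (census rows R60, R61), written there
`Π ∉ i.o.𝒞(s(N))`:

* p. 34 (§4.4): *"we say that (E vs 𝒟) is solved by a ℭ-circuit of size s(N) and denote by
  (E vs 𝒟) ∈ i.o.ℭ(s(N)) if, for every constant c, there exists a family of ℭ-circuits {C_N}_{N∈ℕ}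
  of size s(N) such that C_N solves the promise problem (E^c vs 𝒟)_N for infinitely many N."*
* p. 10 (Thm. 1.11, items 3/4): *"For all large N ∈ ℕ, there exists no AC⁰ ∘ XOR circuit of size
  N^{1+o(1)} that computes MKtP[O(log N), N^{o(1)}]."*; p. 39 (Prop. 4.22): *"for all sufficiently
  large N ∈ ℕ, no NOT ∘ ℭ circuit of size N^k can solve … MKtP[O(log N), N − 1] on input length N."*

So for ONE promise problem `Π`, `Π ∉ i.o.ℭ(s)` says: every family of `ℭ`-circuits of size `s(N)`
solves `Π_N` for only finitely many `N`; equivalently (choosing, for each bad length, a solving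
circuit) FOR ALL SUFFICIENTLY LARGE `N` NO SINGLE `N`-INPUT CIRCUIT of the class solves `Π` restricted
to length `N`. This is the STRONG (almost-everywhere-failure) lower bound; the census's other rows
use the standard notion "`Π ∉ 𝒞[s]`" = no family of the class solves `Π` at every length (failure
infinitely often), rendered in the tree by `Π ∉ promiseLift (FamilyAE P)`.

## What this file provides

* `Circuit.SolvesPromise E Q` — the `N`-input circuit `E` solves the promise problem `Q` AT LENGTH
  `N`: it accepts every YES instance of length `N` and rejects every NO instance of length `N`
  (strings of length `N` are read through `List.ofFn : (Fin N → Bool) → List Bool`, the convention of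
  `CircuitFamily.Decides.eval_eq`).
* `PromiseProblem.EventuallyUnsolvable Q P` — **`Q ∉ i.o.{P-circuits}`**: for all sufficiently large
  `N` (`Filter.atTop` on `ℕ`), no circuit `E : Circuit (Fin N)` with `P N E` solves `Q` at length `N`.
  The constraint `P : ∀ N, Circuit (Fin N) → Prop` is the SAME datum the almost-everywhere classes
  `FamilyAE P` of `FormulaModelsAE` are built from (e.g. `ACdXORae d s = FamilyAE (…)`), so one
  constraint lambda names both the pointwise and the family reading of a printed class.

API (all folklore, fully proved): the unfolding `eventuallyUnsolvable_iff` (`∃ N₀, ∀ N ≥ N₀, …`);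
a deciding family of an a.e. class solves the lifted problem at every length
(`CircuitFamily.Decides.solvesPromise`); hence **the pointwise bound implies the family bound**,
`EventuallyUnsolvable Q P → Q ∉ promiseLift (FamilyAE P)` (`EventuallyUnsolvable.not_mem_promiseLift`),
and even every TAIL of `Q` escapes the class (`EventuallyUnsolvable.tailFrom`,
`EventuallyUnsolvable.tailFrom_not_mem_promiseLift`; cf. `not_mem_promiseLift_iff_forall_tailFrom`);
monotonicity in the constraint (`EventuallyUnsolvable.anti`: fewer admissible circuits, easier
bound) and in the problem (`EventuallyUnsolvable.of_imp`: a problem with MORE instances from some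
length on inherits the bound, since any solver of it solves the smaller problem); and the two
DEGENERACY checks that make the predicate an honest lower bound: if the class eventually contains
the one-gate constant circuits then `EventuallyUnsolvable Q P` forces BOTH sides of `Q` to be
inhabited at every large length (`EventuallyUnsolvable.frequently_yes/no`: otherwise a constant
circuit solves `Q` at that length) — so a typed `∃ c, … ∉ i.o.…` statement cannot be satisfied by
choosing a threshold that empties the YES side: that makes the statement FALSE, not vacuous.
-/

namespace Literature.Computability.MetaComplexity

open Filter Literature.Computability.Complexity

/-! ### Definitions -/

/-- **The `N`-input circuit `E` solves the promise problem `Q` at length `N`**: every YES instance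
of length `N` is accepted and every NO instance of length `N` is rejected (strings of length `N` as
`List.ofFn u`, `u : Fin N → Bool`). Deliberate dot-notation extension of `Complexity.Circuit`.
[cite: Hirahara2023NonDisjoint, §4.4 p. 34 ("C_N solves the promise problem (E^c vs 𝒟)_N")] -/
def _root_.Literature.Computability.Complexity.Circuit.SolvesPromise {N : ℕ} (E : Circuit (Fin N))
    (Q : PromiseProblem) : Prop :=
  ∀ u : Fin N → Bool,
    (List.ofFn u ∈ Q.yes → E.eval u = true) ∧ (List.ofFn u ∈ Q.no → E.eval u = false)

/-- **`Q ∉ i.o.{P-circuits}`** (`Q.EventuallyUnsolvable P`): for all sufficiently large `N`, no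
`N`-input circuit `E` satisfying the constraint `P N E` solves `Q` at length `N` — Hirahara's
*"for all large N ∈ ℕ, there exists no 𝒞 circuit of size s(N) that computes Π"*. The constraint is
the datum of the almost-everywhere class `FamilyAE P`. Deliberate dot-notation extension of
`Complexity.PromiseProblem`. [cite: Hirahara2023NonDisjoint, Thm. 1.11 items 3–4 and §4.4 p. 34 (Π ∉ i.o.ℭ(s))] -/
def _root_.Literature.Computability.Complexity.PromiseProblem.EventuallyUnsolvable
    (Q : PromiseProblem) (P : ∀ N : ℕ, Circuit (Fin N) → Prop) : Prop :=
  ∀ᶠ N : ℕ in atTop, ∀ E : Circuit (Fin N), P N E → ¬ E.SolvesPromise Q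

/-! ### Unfolding -/

/-- `Q ∉ i.o.{P-circuits}` iff from some length `N₀` on no admissible circuit solves `Q`. [folklore] -/
theorem eventuallyUnsolvable_iff {Q : PromiseProblem} {P : ∀ N : ℕ, Circuit (Fin N) → Prop} :
    Q.EventuallyUnsolvable P ↔
      ∃ N₀ : ℕ, ∀ N : ℕ, N₀ ≤ N → ∀ E : Circuit (Fin N), P N E → ¬ E.SolvesPromise Q := by
  unfold PromiseProblem.EventuallyUnsolvable
  rw [eventually_atTop]

/-! ### Solving at a length versus deciding a separating language -/

/-- A circuit family deciding a language `L` that separates `Q` (`Q.yes ≤ L`, `Q.no ≤ Lᶜ`) solves `Q`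
at EVERY length. [folklore] -/
theorem _root_.Literature.Computability.Complexity.CircuitFamily.Decides.solvesPromise
    {C : CircuitFamily} {L : Language Bool} (h : C.Decides L) {Q : PromiseProblem}
    (hy : Q.yes ≤ L) (hn : Q.no ≤ Lᶜ) (N : ℕ) : (C N).SolvesPromise Q := by
  intro u
  refine ⟨fun hu => ?_, fun hu => ?_⟩
  · rw [h.eval_eq u]
    exact (Set.mem_iff_boolIndicator _ _).1 (hy hu)
  · rw [h.eval_eq u]
    exact (Set.notMem_iff_boolIndicator _ _).1 (hn hu)

/-- Solving is antitone in the problem at a fixed length: if every YES (resp. NO) instance of `Q` of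
length `N` is a YES (resp. NO) instance of `R`, a circuit solving `R` at length `N` solves `Q` there.
[folklore] -/
theorem _root_.Literature.Computability.Complexity.Circuit.SolvesPromise.anti {N : ℕ}
    {E : Circuit (Fin N)} {Q R : PromiseProblem} (h : E.SolvesPromise R)
    (hy : ∀ x : List Bool, x.length = N → x ∈ Q.yes → x ∈ R.yes)
    (hn : ∀ x : List Bool, x.length = N → x ∈ Q.no → x ∈ R.no) : E.SolvesPromise Q := fun u =>
  ⟨fun hu => (h u).1 (hy _ (List.length_ofFn ..) hu), fun hu => (h u).2 (hn _ (List.length_ofFn ..) hu)⟩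

/-! ### The pointwise bound implies the family bound -/

section API

variable {Q : PromiseProblem} {P : ∀ N : ℕ, Circuit (Fin N) → Prop}

/-- **`Q ∉ i.o.{P-circuits}` implies `Q ∉ promiseLift (FamilyAE P)`**: a family whose members
satisfy `P` from some length on and which decides a separating language would solve `Q` at every
large length. (The converse fails in general: the family bound only says every family fails
infinitely often.) [folklore] -/
theorem _root_.Literature.Computability.Complexity.PromiseProblem.EventuallyUnsolvable.not_mem_promiseLift
    (h : Q.EventuallyUnsolvable P) : Q ∉ promiseLift (FamilyAE P) := by
  rintro ⟨L, ⟨C, ⟨n₀, hn₀⟩, hCL⟩, hy, hn⟩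
  obtain ⟨N₀, hN₀⟩ := eventuallyUnsolvable_iff.1 h
  exact hN₀ (max N₀ n₀) (le_max_left _ _) (C (max N₀ n₀)) (hn₀ _ (le_max_right _ _))
    (hCL.solvesPromise hy hn _)

/-- The pointwise bound passes to every tail of the problem (instances of length `< N₀` dropped).
[folklore] -/
theorem _root_.Literature.Computability.Complexity.PromiseProblem.EventuallyUnsolvable.tailFrom
    (h : Q.EventuallyUnsolvable P) (N₀ : ℕ) : (Q.tailFrom N₀).EventuallyUnsolvable P := by
  obtain ⟨N₁, hN₁⟩ := eventuallyUnsolvable_iff.1 h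
  refine eventuallyUnsolvable_iff.2 ⟨max N₀ N₁, fun N hN E hE hsol => hN₁ N (le_of_max_le_right hN) E hE ?_⟩
  exact hsol.anti (fun x hx hq => ⟨hx ▸ le_of_max_le_left hN, hq⟩)
    (fun x hx hq => ⟨hx ▸ le_of_max_le_left hN, hq⟩)

/-- Hence NO TAIL of `Q` is separated by a language of `FamilyAE P` — the strong form in which the
census states known bounds (cf. `chop_thm15`, `not_mem_promiseLift_iff_forall_tailFrom`). [folklore] -/
theorem _root_.Literature.Computability.Complexity.PromiseProblem.EventuallyUnsolvable.tailFrom_not_mem_promiseLift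
    (h : Q.EventuallyUnsolvable P) (N₀ : ℕ) :
    Q.tailFrom N₀ ∉ promiseLift (FamilyAE P) :=
  (h.tailFrom N₀).not_mem_promiseLift

/-! ### Monotonicity -/

/-- Antitone in the constraint: if from some length on every `P'`-circuit is a `P`-circuit, a bound
against `P`-circuits is a bound against `P'`-circuits. [folklore] -/
theorem _root_.Literature.Computability.Complexity.PromiseProblem.EventuallyUnsolvable.anti
    (h : Q.EventuallyUnsolvable P) {P' : ∀ N : ℕ, Circuit (Fin N) → Prop}
    (hPP' : ∀ᶠ N : ℕ in atTop, ∀ E : Circuit (Fin N), P' N E → P N E) :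
    Q.EventuallyUnsolvable P' := by
  filter_upwards [h, hPP'] with N hN hN' E hE using hN E (hN' E hE)

/-- Monotone in the problem: if from some length on the YES (resp. NO) instances of `Q` are YES
(resp. NO) instances of `R`, then `Q ∉ i.o.` implies `R ∉ i.o.` (a solver of `R` at a large length
solves `Q` there). [folklore] -/
theorem _root_.Literature.Computability.Complexity.PromiseProblem.EventuallyUnsolvable.of_imp
    (h : Q.EventuallyUnsolvable P) {R : PromiseProblem}
    (hQR : ∃ N₀ : ℕ, ∀ x : List Bool, N₀ ≤ x.length →
      (x ∈ Q.yes → x ∈ R.yes) ∧ (x ∈ Q.no → x ∈ R.no)) :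
    R.EventuallyUnsolvable P := by
  obtain ⟨N₀, hN₀⟩ := hQR
  obtain ⟨N₁, hN₁⟩ := eventuallyUnsolvable_iff.1 h
  refine eventuallyUnsolvable_iff.2 ⟨max N₀ N₁, fun N hN E hE hsol =>
    hN₁ N (le_of_max_le_right hN) E hE (hsol.anti ?_ ?_)⟩
  · exact fun x hx hq => (hN₀ x (hx ▸ le_of_max_le_left hN)).1 hq
  · exact fun x hx hq => (hN₀ x (hx ▸ le_of_max_le_left hN)).2 hq

/-! ### Degeneracy checks: constant circuits solve one-sided lengths -/

/-- At a length with no YES instance the constant-`false` circuit solves `Q`. [folklore] -/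
theorem _root_.Literature.Computability.Complexity.Circuit.const_false_solvesPromise {N : ℕ}
    {Q : PromiseProblem} (h : ∀ x ∈ Q.yes, x.length ≠ N) :
    (Circuit.const (Fin N) false).SolvesPromise Q := fun u =>
  ⟨fun hu => absurd (List.length_ofFn ..) (h _ hu), fun _ => Circuit.eval_const false u⟩

/-- At a length with no NO instance the constant-`true` circuit solves `Q`. [folklore] -/
theorem _root_.Literature.Computability.Complexity.Circuit.const_true_solvesPromise {N : ℕ}
    {Q : PromiseProblem} (h : ∀ x ∈ Q.no, x.length ≠ N) :
    (Circuit.const (Fin N) true).SolvesPromise Q := fun u =>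
  ⟨fun _ => Circuit.eval_const true u, fun hu => absurd (List.length_ofFn ..) (h _ hu)⟩

/-- **Non-degeneracy, YES side**: if the class eventually admits the constant-`false` circuit, then
`Q ∉ i.o.{P-circuits}` forces YES instances of every large length. [folklore] -/
theorem _root_.Literature.Computability.Complexity.PromiseProblem.EventuallyUnsolvable.eventually_exists_yes
    (h : Q.EventuallyUnsolvable P)
    (hP : ∀ᶠ N : ℕ in atTop, P N (Circuit.const (Fin N) false)) :
    ∀ᶠ N : ℕ in atTop, ∃ x ∈ Q.yes, x.length = N := by
  filter_upwards [h, hP] with N hN hPN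
  by_contra hx
  push Not at hx
  exact hN _ hPN (Circuit.const_false_solvesPromise hx)

/-- **Non-degeneracy, NO side**: if the class eventually admits the constant-`true` circuit, then
`Q ∉ i.o.{P-circuits}` forces NO instances of every large length. [folklore] -/
theorem _root_.Literature.Computability.Complexity.PromiseProblem.EventuallyUnsolvable.eventually_exists_no
    (h : Q.EventuallyUnsolvable P)
    (hP : ∀ᶠ N : ℕ in atTop, P N (Circuit.const (Fin N) true)) :
    ∀ᶠ N : ℕ in atTop, ∃ x ∈ Q.no, x.length = N := by
  filter_upwards [h, hP] with N hN hPN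
  by_contra hx
  push Not at hx
  exact hN _ hPN (Circuit.const_true_solvesPromise hx)

end API

end Literature.Computability.MetaComplexity
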